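import Mathlib
import Summits.Ventures.PercRepro.TriangleCapEightThirteenE

/-!
# PercRepro — THREE BELOW THE DIAGONAL, ONE TRIANGLE, NO OUTER VERTEX, PART C: THE FOUR-BLOCK COUNT FOR EVERY
`k` AND THE MANTEL CASE (p3, gen 38; part 104)

`S = {u, v, w}` the only triangle, every vertex off `S` adjacent to exactly one of `u, v, w` (no outer vertex),
`n = |Sᶜ|`, `Q′ = Σ_{z ∉ S} degIn Sᶜ z` (`= 2 e`, `e` the edges inside `Sᶜ`), `sq = Σ_{x ∈ S} (degIn Sᶜ x)²`
(the private degrees `a, b, c`, `a + b + c = n`, `n² − sq = 2 (ab + bc + ca)`), `sqP = Σ_{z ∉ S} (degIn Sᶜ z)²`.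
The far count of the vertices off `S` as the four blocks of `sum_far_eq_double D Sᶜ` (TriangleCapTwoTrianglesEightB's
`block_cross` / `block_outside`, TriangleCapEightThirteenE's `block_inside_self`), and `far(x) ≥ Q′ − 2 W(x)` on
`S` (`block_outside D S`), all EXACT in this configuration, give
**`one_triangle_no_outer_count`**: `2n + 2n² + n Q′ ≤ Σ deficit + 2 sqP + 2 sq + Q′`, with Mantel inside `Sᶜ`
(`2 sqP ≤ n Q′`, `two_mul_sum_sq_le_of_no_triangle`), the private sets independent (`Q′ + sq ≤ n²`) and the density
`2m = 6 + 2n + Q′` — the generalisation of the cells `(8, 13)` and `(9, 16)` (parts 78 and 74) to every `n`.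
Hence **`one_triangle_stability_three_no_outer_of_large`**: whenever `4n + Q′ + 2 sq ≤ 2n²`, i.e.
`2 (ab + bc + ca) ≥ 2n + e`, `Σ deficit ≥ 6n` and `Σ_v d(v)² + 3 (k − 4) ≤ m k`.  The residue (`ab + bc + ca` small:
two private sets of total size `≤ 2`, `partition_small_of_sigma_lt`) is part D.  Axioms: standard.
-/

namespace PercRepro

namespace TriangleCap

namespace C047

open Finset

variable {V : Type*} [Fintype V] [DecidableEq V]

/-- **THE FOUR-BLOCK COUNT WITHOUT AN OUTER VERTEX, EVERY `k`:** with `n = |Sᶜ|`, `Q′`, `sq`, `sqP` as above,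
`2n + 2n² + n Q′ ≤ Σ deficit + 2 sqP + 2 sq + Q′`, `2 sqP ≤ n Q′`, `Q′ + sq ≤ n²` and `2m = 6 + 2n + Q′`. -/
theorem one_triangle_no_outer_count (D : SimpleGraph V) [DecidableRel D.Adj] (hK : K4mFree D) {u v w : V}
    (huv : D.Adj u v) (huw : D.Adj u w) (hvw : D.Adj v w)
    (hT : ∀ a b c, D.Adj a b → D.Adj a c → D.Adj b c → a = u ∨ a = v ∨ a = w)
    (hq : ∀ z, z ∉ ({u, v, w} : Finset V) → 1 ≤ degIn D {u, v, w} z) :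
    2 * (({u, v, w} : Finset V)ᶜ).card + 2 * ((({u, v, w} : Finset V)ᶜ).card * (({u, v, w} : Finset V)ᶜ).card) +
        (({u, v, w} : Finset V)ᶜ).card * ∑ z ∈ ({u, v, w} : Finset V)ᶜ, degIn D ({u, v, w} : Finset V)ᶜ z ≤
      ∑ p ∈ adjPairsAll D, deficit D p +
        2 * ∑ z ∈ ({u, v, w} : Finset V)ᶜ, degIn D ({u, v, w} : Finset V)ᶜ z * degIn D ({u, v, w} : Finset V)ᶜ z +
        2 * ∑ x ∈ ({u, v, w} : Finset V), degIn D ({u, v, w} : Finset V)ᶜ x * degIn D ({u, v, w} : Finset V)ᶜ x +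
        ∑ z ∈ ({u, v, w} : Finset V)ᶜ, degIn D ({u, v, w} : Finset V)ᶜ z ∧
    2 * ∑ z ∈ ({u, v, w} : Finset V)ᶜ, degIn D ({u, v, w} : Finset V)ᶜ z * degIn D ({u, v, w} : Finset V)ᶜ z ≤
      (({u, v, w} : Finset V)ᶜ).card * ∑ z ∈ ({u, v, w} : Finset V)ᶜ, degIn D ({u, v, w} : Finset V)ᶜ z ∧
    ∑ z ∈ ({u, v, w} : Finset V)ᶜ, degIn D ({u, v, w} : Finset V)ᶜ z +
        ∑ x ∈ ({u, v, w} : Finset V), degIn D ({u, v, w} : Finset V)ᶜ x * degIn D ({u, v, w} : Finset V)ᶜ x ≤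
      (({u, v, w} : Finset V)ᶜ).card * (({u, v, w} : Finset V)ᶜ).card ∧
    2 * D.edgeFinset.card = 6 + 2 * (({u, v, w} : Finset V)ᶜ).card +
      ∑ z ∈ ({u, v, w} : Finset V)ᶜ, degIn D ({u, v, w} : Finset V)ᶜ z := by
  set S : Finset V := {u, v, w} with hS
  have h3 : S.card = 3 := card_triple huv.ne huw.ne hvw.ne
  have hcl := clique_triple D huv huw hvw
  have hQ : adjPairs D S = 6 := by
    rw [adjPairs_eq_sum_degIn, sum_congr rfl (fun x hx => degIn_self_of_clique D h3 hcl hx), sum_const, h3,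
      smul_eq_mul]
  have hs1 : ∀ z ∈ Sᶜ, degIn D S z = 1 := by
    intro z hz
    have h1 : degIn D S z ≤ 1 := degIn_le_one_of_triangle D hK huv huw hvw (mem_compl.mp hz)
    have h2 : 1 ≤ degIn D S z := hq z (mem_compl.mp hz)
    omega
  have hsum1 : ∑ z ∈ Sᶜ, degIn D S z = Sᶜ.card := by
    rw [sum_congr rfl hs1, sum_const, smul_eq_mul, mul_one]
  have hcomm := sum_degIn_comm D S Sᶜ
  rw [hsum1] at hcomm
  have hdens := two_mul_card_edges_eq_adjPairs_add D S
  rw [hQ, hsum1] at hdens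
  set Q' := ∑ z ∈ Sᶜ, degIn D Sᶜ z with hQ'
  have hW' : ∑ x ∈ S, ∑ y ∈ Sᶜ.filter (fun y => D.Adj x y), degIn D Sᶜ y = Q' := by
    rw [hQ']
    have := double_sum_ite_swap D Sᶜ S (fun y _ => degIn D Sᶜ y)
    rw [double_sum_ite_left] at this
    rw [← this]
    exact sum_congr rfl (fun y hy => by rw [hs1 y hy, one_mul])
  -- the far count of the vertices off `S`: the four blocks for `Sᶜ`
  have hfarR := sum_far_eq_double D Sᶜ
  rw [double_sum_split Sᶜ, compl_compl] at hfarR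
  have hcross := block_cross D Sᶜ
  rw [compl_compl, hcomm, hW'] at hcross
  have hswap := block_cross_swap D Sᶜ
  rw [compl_compl] at hswap
  have hSS := block_outside D Sᶜ
  rw [compl_compl] at hSS
  have hSSdeg : ∑ x ∈ S, degIn D S x = 6 := by
    rw [sum_congr rfl (fun x hx => degIn_self_of_clique D h3 hcl hx), sum_const, h3, smul_eq_mul]
  have hSSprod : ∑ x ∈ S, degIn D Sᶜ x * degIn D S x = 2 * Sᶜ.card := by
    have e : ∀ x ∈ S, degIn D Sᶜ x * degIn D S x = degIn D Sᶜ x * 2 := fun x hx => by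
      rw [degIn_self_of_clique D h3 hcl hx]
    calc ∑ x ∈ S, degIn D Sᶜ x * degIn D S x = (∑ x ∈ S, degIn D Sᶜ x) * 2 := by
          rw [sum_congr rfl e, sum_mul]
      _ = 2 * Sᶜ.card := by rw [hcomm, mul_comm]
  rw [hSSdeg, hSSprod] at hSS
  have hB1 := block_inside_self D Sᶜ
  rw [← hQ'] at hB1
  -- the far count of the vertices of `S`: the block `Sᶜ × Sᶜ`
  have hfarS := sum_far_eq_double D S
  rw [double_sum_split S] at hfarS
  have hout := block_outside D S
  rw [h3] at hout
  have hsd : ∑ z ∈ Sᶜ, degIn D S z * degIn D Sᶜ z = Q' := by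
    rw [hQ']
    exact sum_congr rfl (fun z hz => by rw [hs1 z hz, one_mul])
  rw [hsd] at hout
  -- no triangle with a vertex off `S`
  have hnotri : ∀ y, y ∉ S → ∀ y' t, D.Adj y y' → D.Adj y t → D.Adj y' t → False := by
    intro y hy y' t h1 h2 h3'
    have := hT y y' t h1 h2 h3'
    rw [hS] at hy
    simp only [mem_insert, mem_singleton] at hy
    exact hy this
  -- Mantel inside `Sᶜ`: `2 Σ d(y)² ≤ n Q′`
  have hsqP := two_mul_sum_sq_le_of_no_triangle D Sᶜ (fun y hy y' _ t _ h1 h2 h3' =>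
    hnotri y (mem_compl.mp hy) y' t h1 h2 h3')
  rw [← hQ'] at hsqP
  -- the private sets are independent: `Q′ ≤ Σ_x d_x (n − d_x)`
  have hpriv : ∀ x ∈ S, ∀ y ∈ Sᶜ, D.Adj x y → degIn D Sᶜ y + degIn D Sᶜ x ≤ Sᶜ.card := by
    intro x hx y hy hxy
    have hdisj : Disjoint (Sᶜ.filter (fun t => D.Adj y t)) (Sᶜ.filter (fun t => D.Adj x t)) := by
      rw [disjoint_left]
      intro t ht1 ht2
      rw [mem_filter] at ht1 ht2
      exact hnotri y (mem_compl.mp hy) x t hxy.symm ht1.2 ht2.2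
    have := card_le_card (union_subset (filter_subset _ _) (filter_subset _ _) :
      Sᶜ.filter (fun t => D.Adj y t) ∪ Sᶜ.filter (fun t => D.Adj x t) ⊆ Sᶜ)
    rw [card_union_of_disjoint hdisj] at this
    exact this
  have hQ'le : Q' ≤ ∑ x ∈ S, degIn D Sᶜ x * (Sᶜ.card - degIn D Sᶜ x) := by
    rw [hQ']
    have e1 : ∑ y ∈ Sᶜ, degIn D Sᶜ y = ∑ x ∈ S, ∑ y ∈ Sᶜ, if D.Adj x y then degIn D Sᶜ y else 0 := by
      rw [double_sum_ite_right]
      exact sum_congr rfl (fun y hy => by rw [hs1 y hy, one_mul])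
    rw [e1]
    calc ∑ x ∈ S, ∑ y ∈ Sᶜ, (if D.Adj x y then degIn D Sᶜ y else 0) ≤
        ∑ x ∈ S, ∑ y ∈ Sᶜ, (if D.Adj x y then Sᶜ.card - degIn D Sᶜ x else 0) := by
          apply sum_le_sum
          intro x hx
          apply sum_le_sum
          intro y hy
          by_cases hxy : D.Adj x y
          · simp only [hxy, if_true]
            have := hpriv x hx y hy hxy
            omega
          · simp [hxy]
      _ = ∑ x ∈ S, degIn D Sᶜ x * (Sᶜ.card - degIn D Sᶜ x) := double_sum_ite_left D S Sᶜ _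
  have hsqle : ∑ x ∈ S, degIn D Sᶜ x * (Sᶜ.card - degIn D Sᶜ x) + ∑ x ∈ S, degIn D Sᶜ x * degIn D Sᶜ x =
      Sᶜ.card * Sᶜ.card := by
    rw [← sum_add_distrib]
    have e : ∀ x ∈ S, degIn D Sᶜ x * (Sᶜ.card - degIn D Sᶜ x) + degIn D Sᶜ x * degIn D Sᶜ x =
        Sᶜ.card * degIn D Sᶜ x := by
      intro x hx
      have hle : degIn D Sᶜ x ≤ Sᶜ.card := degIn_le_card D Sᶜ x
      rw [← mul_add, Nat.sub_add_cancel hle, mul_comm]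
    rw [sum_congr rfl e, ← mul_sum, hcomm]
  have hid := sum_deficit_eq_sum_far D
  rw [← sum_add_sum_compl S (far D)] at hid
  refine ⟨?_, hsqP, by omega, hdens⟩
  rw [hid, hfarS, hfarR]
  omega

/-- **THE MANTEL CASE WITHOUT AN OUTER VERTEX:** `K₄⁻`-free, the only triangle `u v w`, no outer vertex, and
`4n + Q′ + 2 sq ≤ 2n²` (i.e. `2 (ab + bc + ca) ≥ 2n + e`), `k ≥ 4` ⇒ `Σ_v d(v)² + 3 (k − 4) ≤ m k`. -/
theorem one_triangle_stability_three_no_outer_of_large (D : SimpleGraph V) [DecidableRel D.Adj] (hK : K4mFree D)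
    {u v w : V} (huv : D.Adj u v) (huw : D.Adj u w) (hvw : D.Adj v w)
    (hT : ∀ a b c, D.Adj a b → D.Adj a c → D.Adj b c → a = u ∨ a = v ∨ a = w)
    (hq : ∀ z, z ∉ ({u, v, w} : Finset V) → 1 ≤ degIn D {u, v, w} z) (hk : 4 ≤ Fintype.card V)
    (hA : 4 * (({u, v, w} : Finset V)ᶜ).card + ∑ z ∈ ({u, v, w} : Finset V)ᶜ, degIn D ({u, v, w} : Finset V)ᶜ z +
      2 * ∑ x ∈ ({u, v, w} : Finset V), degIn D ({u, v, w} : Finset V)ᶜ x * degIn D ({u, v, w} : Finset V)ᶜ x ≤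
      2 * ((({u, v, w} : Finset V)ᶜ).card * (({u, v, w} : Finset V)ᶜ).card)) :
    ∑ v, deg D v * deg D v + 3 * (Fintype.card V - 4) ≤ D.edgeFinset.card * Fintype.card V := by
  obtain ⟨hcount, hsqP, -, hdens⟩ := one_triangle_no_outer_count D hK huv huw hvw hT hq
  set S : Finset V := {u, v, w} with hS
  have h3 : S.card = 3 := card_triple huv.ne huw.ne hvw.ne
  have hk' : Fintype.card V = Sᶜ.card + 3 := by
    have := card_add_card_compl S
    omega
  have hid := two_mul_sum_deg_sq_add_sum_deficit D
  have h6 := card_triangles3_le_six D hT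
  rw [hk'] at hid hk ⊢
  set n := Sᶜ.card with hn
  set Q' := ∑ z ∈ Sᶜ, degIn D Sᶜ z with hQ'
  set sq := ∑ x ∈ S, degIn D Sᶜ x * degIn D Sᶜ x with hsq
  set sqP := ∑ z ∈ Sᶜ, degIn D Sᶜ z * degIn D Sᶜ z with hsqPdef
  set Def := ∑ p ∈ adjPairsAll D, deficit D p with hDef
  set X := ∑ v, deg D v * deg D v with hX
  set m := D.edgeFinset.card with hm
  clear_value n Q' sq sqP Def X m
  have hDef6 : 6 * n ≤ Def := by
    have h1 : n * Q' + 2 * (n * n) ≤ Def + 2 * sqP + 2 * sq + Q' + 2 * (n * n) - 2 * n := by omega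
    omega
  have hmk : 2 * m * (n + 3) = 2 * (m * (n + 3)) := by ring
  omega

omit [Fintype V] [DecidableEq V] in
/-- A partition `a + b + c = n` with `ab + bc + ca ≤ 2n − 4` and `n ≥ 6`, or with `ab + bc + ca < 2n` and `n ≥ 9`,
has two parts of total size at most `2`. -/
theorem partition_small_of_sigma_lt (a b c n : ℕ) (h : a + b + c = n)
    (hsig : (a * b + b * c + c * a + 4 ≤ 2 * n ∧ 6 ≤ n) ∨ (a * b + b * c + c * a < 2 * n ∧ 9 ≤ n)) :
    b + c ≤ 2 ∨ a + c ≤ 2 ∨ a + b ≤ 2 := by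
  by_contra hcon
  push Not at hcon
  obtain ⟨h1, h2, h3⟩ := hcon
  -- every pair sum is `≥ 3`: if some part is `0` the other two are `≥ 3`, else at most one part is `1`
  rcases Nat.eq_zero_or_pos a with ha | ha
  · subst ha
    have hb : 3 ≤ b := by omega
    have hc : 3 ≤ c := by omega
    have : 3 * (n - 3) ≤ b * c := by
      obtain ⟨b', hb'⟩ : ∃ b', b = b' + 3 := ⟨b - 3, by omega⟩
      obtain ⟨c', hc'⟩ : ∃ c', c = c' + 3 := ⟨c - 3, by omega⟩
      subst hb' hc'
      have : n - 3 = b' + c' + 3 := by omega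
      rw [this]
      nlinarith
    rcases hsig with ⟨hs, hn⟩ | ⟨hs, hn⟩ <;> omega
  rcases Nat.eq_zero_or_pos b with hb | hb
  · subst hb
    have ha3 : 3 ≤ a := by omega
    have hc : 3 ≤ c := by omega
    have : 3 * (n - 3) ≤ c * a := by
      obtain ⟨a', ha'⟩ : ∃ a', a = a' + 3 := ⟨a - 3, by omega⟩
      obtain ⟨c', hc'⟩ : ∃ c', c = c' + 3 := ⟨c - 3, by omega⟩
      subst ha' hc'
      have : n - 3 = a' + c' + 3 := by omega
      rw [this]
      nlinarith
    rcases hsig with ⟨hs, hn⟩ | ⟨hs, hn⟩ <;> omega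
  rcases Nat.eq_zero_or_pos c with hc | hc
  · subst hc
    have ha3 : 3 ≤ a := by omega
    have hb3 : 3 ≤ b := by omega
    have : 3 * (n - 3) ≤ a * b := by
      obtain ⟨a', ha'⟩ : ∃ a', a = a' + 3 := ⟨a - 3, by omega⟩
      obtain ⟨b', hb'⟩ : ∃ b', b = b' + 3 := ⟨b - 3, by omega⟩
      subst ha' hb'
      have : n - 3 = a' + b' + 3 := by omega
      rw [this]
      nlinarith
    rcases hsig with ⟨hs, hn⟩ | ⟨hs, hn⟩ <;> omega
  -- all parts positive: a part equal to `1` leaves two parts `≥ 2` whose product is `≥` their sum (`+ 2` when the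
  -- sum is `≥ 8`); otherwise `ab + bc + ca ≥ 2 (a + b + c) = 2n`
  have key : ∀ p q : ℕ, 2 ≤ p → 2 ≤ q → p + q ≤ p * q ∧ (8 ≤ p + q → p + q + 2 ≤ p * q) := by
    intro p q hp hq
    obtain ⟨p', hp'⟩ : ∃ p', p = p' + 2 := ⟨p - 2, by omega⟩
    obtain ⟨q', hq'⟩ : ∃ q', q = q' + 2 := ⟨q - 2, by omega⟩
    subst hp' hq'
    have e : (p' + 2) * (q' + 2) = p' * q' + 2 * p' + 2 * q' + 4 := by ring
    rw [e]
    omega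
  rcases Nat.lt_or_ge a 2 with ha1 | ha2
  · have ha1' : a = 1 := by omega
    subst ha1'
    obtain ⟨k1, k2⟩ := key b c (by omega) (by omega)
    rcases hsig with ⟨hs, hn⟩ | ⟨hs, hn⟩
    · omega
    · have := k2 (by omega)
      omega
  rcases Nat.lt_or_ge b 2 with hb1 | hb2
  · have hb1' : b = 1 := by omega
    subst hb1'
    obtain ⟨k1, k2⟩ := key c a (by omega) (by omega)
    rcases hsig with ⟨hs, hn⟩ | ⟨hs, hn⟩
    · omega
    · have := k2 (by omega)
      omega
  rcases Nat.lt_or_ge c 2 with hc1 | hc2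
  · have hc1' : c = 1 := by omega
    subst hc1'
    obtain ⟨k1, k2⟩ := key a b (by omega) (by omega)
    rcases hsig with ⟨hs, hn⟩ | ⟨hs, hn⟩
    · omega
    · have := k2 (by omega)
      omega
  have h2a : a * 2 ≤ a * b := Nat.mul_le_mul_left a hb2
  have h2b : b * 2 ≤ b * c := Nat.mul_le_mul_left b hc2
  have h2c : c * 2 ≤ c * a := Nat.mul_le_mul_left c ha2
  rcases hsig with ⟨hs, hn⟩ | ⟨hs, hn⟩ <;> omega

end C047

end TriangleCap

end PercRepro
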